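import Summits.QuantumFields.YangMills.Theses.UnitScaleTilt
import Literature.MathematicalPhysics.QuantumFieldTheory.Balaban1983to89.T3AveragedTailProfile

/-!
# Route `UnitScaleTilt` — crux K2 `HistoryTail` (stmt-QuantumFields-18916), birth v3b: the registered stub
# `stub_tailOfPerPlaquette` PROVED with the v3b SIGNATURE VERBATIM (support file; K2 itself stays open)

Cell `ym3-torus` (HUMAN RULING D-0037, YM ladder rung R3), seat `ym3-torus-p1` gen 8, answering the route owner's WANTED of
2026-08-26T07:22Z.  The BC3 birth v3b of K2 (`HOME/route-R3/ym/plan-g11/HistoryTail_birth_v3b.lean`, registered 07:19:25Z, skeleton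
sha16 `cf09887d813eb370`) spells the `j`-fold block averaging `Averaging.iter (fun _ => BlockAveraging.blockAvg ℰp) j U` (implicit
`P`, `j`); the v3 birth (and the landed helper `Theorems.stub_tailOfPerPlaquette`, p429449, seat p2 gen 7) spelled it with named
arguments `(P := F.P K) (j := i)`, which the registry truncated.  The two statements are definitionally equal; this file restates the
bookkeeping stub with the REGISTERED v3b text, proved by the same tree theorem
`T3AveragedTailProfile.averagedTailAt_of_perPlaquette` (p429150: union bound over the `≤ 9·(2L^{m+K−j})³` plaquettes of height `j`
along the `j`-fold averaging, `β_i^A = γ^{−A}L^{iA}`, `p(g_i) ≥ ½b₀ i log L`, completing the square).  NOT a proof of K2: the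
located content is `stub_perPlaquetteOfAlpha` (per-plaquette large-field Gibbs tail under Bałaban's (α) package).
-/

noncomputable section

open Literature.MathematicalPhysics.QuantumFieldTheory.Balaban1983to89
open Literature.MathematicalPhysics.QuantumFieldTheory.Balaban1983to89.T3ContinuumYM3Torus
open Literature.MathematicalPhysics.QuantumFieldTheory.Balaban1983to89.T3UnitScaleTilt
open Literature.MathematicalPhysics.QuantumFieldTheory.Balaban1983to89.T3UnitLawDensityEML
open Literature.MathematicalPhysics.QuantumFieldTheory.Balaban1983to89.T3CruxEstimates
open Literature.MathematicalPhysics.QuantumFieldTheory.Balaban1983to89.T3BareTailProfile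
open Literature.MathematicalPhysics.QuantumFieldTheory.Balaban1983to89.T3AveragedTailProfile

namespace Summit.QuantumFields.YangMills.Theorems.HistoryTailBirthV3b

/-- **REGISTERED STUB `stub_tailOfPerPlaquette` OF K2's BIRTH v3b, PROVED** (signature verbatim, v3b spelling of the iterated
averaging): for every family `F`, coupling `0 < γ ≤ 1` and profile `0 < b₀`, `1 ≤ p₀`, a per-plaquette, per-height large-field Gibbs
tail `Gibbs_K{U : θ(K−j) ≤ |Ū^{j}(∂p) − 1|} ≤ C·β_{K−j}^A·exp(−c·p(g_{K−j})²)` (`C ≥ 0`, `A : ℕ`, `c > 0`; all `K`, `1 ≤ j ≤ K`, `p`)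
implies `AveragedTailAt F γ b₀ p₀` — by `T3AveragedTailProfile.averagedTailAt_of_perPlaquette`. -/
theorem stub_tailOfPerPlaquette :
    ∀ (F : T3Family) (γ b₀ p₀ : ℝ), 0 < γ → γ ≤ 1 → 0 < b₀ → 1 ≤ p₀ →
      (∃ (C : ℝ) (A : ℕ) (c : ℝ), 0 ≤ C ∧ 0 < c ∧
          ∀ (K j : ℕ), 1 ≤ j → j ≤ K → ∀ p : Plaq (F.P K) j,
            (gibbsK F ℰp γ K).real
                {U | θBal F.L γ b₀ p₀ (K - j) ≤
                  GaugeGroup.dist1 (GaugeField.plaqHol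
                    (Averaging.iter (fun _ => BlockAveraging.blockAvg ℰp) j U) p)} ≤
              C * (F.scheme ℰp γ).β (K - j) ^ A *
                Real.exp (-(c * B10.pFun b₀ p₀ (Real.sqrt (γ * ((F.L : ℝ)⁻¹) ^ (K - j))) ^ 2))) →
        AveragedTailAt F γ b₀ p₀ :=
  fun F _ _ _ hγ hγ1 hb hp h => averagedTailAt_of_perPlaquette F hγ hγ1 hb hp h

end Summit.QuantumFields.YangMills.Theorems.HistoryTailBirthV3b

end
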